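import Summits.QuantumFields.YangMills.Theorems.BalabanUVNodesN22W1RelCentredTermDatum214
import Summits.QuantumFields.YangMills.Theorems.BalabanUVNodesN22W1RelCentredVertexHeredityAdm

/-!
# BalabanUVNodes ∕ node N22 = NE9 — THE RELATIVE-DISC CENTRED ROAD OVER THE ADMISSIBLE CLASS, MODULE R2ᴬ: THE θ-FREE ENGINE AT THE (2.14) TERM DATUM — node N18 below + the GUARDED
# per-term schemas (S-last-T′)ᴬ ∕ (S-226-T′)ᴬ ∕ (S-vertex-T′)ᴬ + (T-an)[TFc] ∕ (T-an)[V] for a CONTINUED family agreeing with the datum's (2.14) display on the real window, on RELATIVE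
# sectors ⟹ `N22At` at the admissible reading of record on the generated run towers (the ADMISSIBLE-HISTORY edition of module R2 §2)

Cell `pub-ymgap`, HUMAN RULING D-0062 (Track A), R134 ACCELERATION re-seat `pub-ymgap-dag-n22-c` (strategy s1), generation 8, file R2ᴬ of the ADMISSIBLE-HISTORY EDITION SWEEP (lens
«transfer» Cards T32∕T35, node00-def-W1 (R-a) ∕ W1-13, `J10-DESIGN.md` §0 (A2)).  THEOREMS ONLY; imports module R2 `…N22W1RelCentredTermDatum214` (§1 `relCentred_re_section`, R0's junction
`n22At_u3OfRecord₁₂_ofRecordAdm_runTowers_of_n18Below_relCentred`, the datum `TermData214`) and module R1bᴬ `…N22W1RelCentredVertexHeredityAdm` (R1aᴬ §3 `holoBound_recTerm_ofTerms_adm`,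
R1bᴬ §3 `centred_recTerm_ofTerms_adm`) BY NAME.  `--supports` K3⁷ `SpineGivenEndpointR13SepCoPH` (stmt-QuantumFields-20544) as a helper.

WHY ∕ WHAT.  Module R2's engine `…_relCentredTermDatum` VERBATIM (statement and proof), except: every `∀ old` ∕ older-term-curve binder of (S-last-T′), (S-226-T′)[TFc, V], (S-vertex-T′) is
GUARDED by «analytic on the space tables of record» in addition to (1.18) (lens T32: the size-only binders are uninhabitable at the faithful datum; (R-a)); three new displayed inputs —
`hrestr` (the tables' restriction property, [II] p. 15; dag-n18-c `…N18HLayerW1SpaceRestr` at the residual of record), (T-an)[TFc] and (T-an)[V] (termwise φ-analyticity at admissible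
older terms, [II] (2.14) p. 15 «analytic function of (U, J)» with Lemma 2 — dag-n18-c's (T-an) VERBATIM, read per slot of the sector), and N18's STRICT [KP86] clause `< 1`; inside, R1a∕R1b
are replaced by R1aᴬ∕R1bᴬ.  Conclusion unchanged: `N22At (u3OfRecord₁₂ θ (Dr.u3Objects θ.γ) k)` at `Dr := ReadingData.ofRecordAdm F M N (runTowers fun k₁ ↦ toClusterTower (Gn k₁)) …`.

HONEST FRAMING.  Count-neutral by-name knit AT THE OBJECT; NOT a discharge of N22.  Every schema is a DISPLAYED hypothesis on the (continued) term functional of record and asserted nowhere;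
node N18 below is N18's; the datum is DATA; no inhabitant of the record ∕ admissible tuple is claimed (K0 OPEN); vacuous where `AdmBg … = ∅`.  NE9 NOT IN PRINT for d = 4; one finite
four-torus programme at fixed ε — NOT infinite volume, NOT OS on ℝ⁴, NOT a mass gap, NOT Clay.  0 `sorry`, 0 `def`, standard axioms.

References (TYPES only): [I] = [Balaban1987RG1] (0.23)–(0.25) pp. 256–257, §1 p. 263 ((1.18) and the clause before it), (2.9) p. 266, (2.10) p. 267, (2.13) p. 268; [II] =
[Balaban1988RG2Cluster] (1.41) p. 11, (2.9)–(2.15) pp. 14–16, (2.26) p. 17, Lemma 3 p. 20, (2.39)–(2.41) p. 21, p. 22.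
-/

noncomputable section

open scoped Matrix.Norms.L2Operator

namespace YMDAG.N22.W1

open Set Metric
open scoped BigOperators ComplexConjugate
open Literature.MathematicalPhysics.QuantumFieldTheory.Balaban1983to89
open Literature.MathematicalPhysics.QuantumFieldTheory.Balaban1983to89.T4Continuum
open Literature.MathematicalPhysics.QuantumFieldTheory.Balaban1983to89.T4OutputRate
open Literature.MathematicalPhysics.QuantumFieldTheory.Balaban1983to89.TreeLengthTorus (TPt TDom tsys torusTreeLen torusTreeLen_nonneg)
open Literature.MathematicalPhysics.QuantumFieldTheory.Balaban1983to89.B12TreeDecay (K₀ K₀_pos)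
open Literature.MathematicalPhysics.QuantumFieldTheory.Balaban1983to89.B13Lemma3TorusData (TBond)
open Literature.MathematicalPhysics.QuantumFieldTheory.Balaban1983to89.B13Lemma3TorusTerms (terms weight weight_nonneg)
open Literature.MathematicalPhysics.QuantumFieldTheory.Balaban1983to89.B13Lemma3TorusSocket (Lemma3Numerics)
open Literature.MathematicalPhysics.QuantumFieldTheory.Balaban1983to89.Step (SFConsts)
open Literature.MathematicalPhysics.QuantumFieldTheory.Balaban1983to89.Node00
  (Stage12Params Stage13Params U3Objects₁₁ U3Letters₁₁ NE2Objects₁₁ NE3Letters₁₁ MatA ιSU prependCoupling)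
open Literature.MathematicalPhysics.QuantumFieldTheory.Balaban1983to89.Node00.Sect2 (domSys domCount CPair ofBackgroundC spaceI domSites Setting Residual)
open Literature.MathematicalPhysics.QuantumFieldTheory.Balaban1983to89.Node00.W1
open YMDAG.UVSplit

variable {N : ℕ} [NeZero N]

/-! ## §1 The θ-free engine at the (2.14) datum on the relative-disc centred road, OVER THE ADMISSIBLE CLASS -/

section Engine

variable {F : T4Family} {M : ℕ} [NeZero M] {L : ℕ} [NeZero L] (Gn : (k₁ : ℕ) → GenTower (F.P k₁) (MatA N) M)
  (sp : (k j : ℕ) → (domSys (F.P k) M j).Dom → Set (CPair (F.P k) (MatA N)))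
  (gauge : (k : ℕ) → GaugeField (F.P k) 0 (Node00.SU N) → GaugeField (F.P k) 0 (Node00.SU N) → ℝ) (hg : ∀ k U U', 0 ≤ gauge k U U')
  (T₀ : (k : ℕ) → GaugeField (F.P (k + 1)) 0 (Node00.SU N) → GaugeField (F.P k) 0 (Node00.SU N))
  (hT₀ : ∀ (k : ℕ) (U : GaugeField (F.P (k + 1)) 0 (Node00.SU N)),
    (∀ (j : ℕ) (Y : (domSys (F.P (k + 1)) M j).Dom), ofBackgroundC (ιSU N) U ∈ sp (k + 1) j Y) →
    ∀ (j : ℕ) (Y : (domSys (F.P k) M j).Dom), ofBackgroundC (ιSU N) (T₀ k U) ∈ sp k j Y)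
  (li : LetterInputs) (θ : Stage12Params F N) (k : ℕ) (c : B13.Consts) (𝔇 : TermData214 c (F.P k) (MatA N) M L)
  (TFc : GenTermFun (F.P k) (MatA N) M L)
  (V : (k' : ℕ) → (domSys (F.P k) M (k' + 1)).Dom → TermLabel (F.P k) M k' L → OlderTerms (F.P k) (MatA N) M k' → CPair (F.P k) (MatA N) → ℂ)
  (D : ℕ → Set ℂ) {G : Type*} [GaugeGroup G] (Sg : Setting (MatA N) G) (Rz : Residual (F.P k) (MatA N))

open Classical in
/-- **`N22At` AT THE ADMISSIBLE READING OF RECORD ON GENERATED RUN TOWERS WHOSE GENERATOR AT THE RUN LENGTH IS THE (2.14) DATUM's, FROM THE RELATIVE-DISC CENTRED SCHEMAS OVER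
THE ADMISSIBLE CLASS OF OLDER TERMS** — module R2's engine `…_relCentredTermDatum` with every older-term binder GUARDED by [I] p. 263's class «(1.18)`(E₀, li.κ)` on the space tables
of record ∧ analytic there» (node00-def-W1 `W1.AdmHist (W1.spaceOfRecord Sg Rz (fun _ => cs.α₀) (fun _ => cs.α₁)) E₀ li.κ k′`, by `Iff.rfl`), PLUS the tables' restriction property
`hrestr`, the termwise φ-analyticity schemas (T-an)[TFc] (slot-wise on `D`) and (T-an)[V] at (1.18)`(E₀,r₁)`-bounded analytic older terms (dag-n18-c's shape), and N18's STRICT [KP86]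
clause; the heredity is R1aᴬ §3 ∕ R1bᴬ §3.  THE REST AS IN MODULE R2:
(`Gn k = 𝔇.Gn`; the other run lengths' generators free).  Displayed: the run-length-`k` table inside the space table of record; socket numerals AT `a₅′` with the weight slack
`2·e^{a₅|Z|} ≤ e^{a₅′|Z|}`, S25's clauses, the renewal `… ≤ E₀`; a domain family `D` (open sets containing the window points and the RELATIVE closed discs `closedBall (t:ℂ)(cA·t)`,
`0 < cA < 1` — a sector); the smallness `Mv·((1+cA)γ)² ≤ ½` and the letter relation `2·Mv·E₀·(1+cA)² ≤ li.A`; a CONTINUED term-functional family `TFc` AGREEING WITH THE DATUM ON THE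
REAL WINDOW; a coupling-blind centre `V`; below the run length: (S-last-T′) for `TFc` on `D k′`, (S-226-T′) for `TFc` at every `u ∈ D k′` and for `V` on EVERY open set (older terms
(1.18)-bounded by `E₀·e^{−li.κ d}` on the space tables), (S-vertex-T′) ‖TFc k′ Z t z old φ − V k′ Z t old φ‖ ≤ Mv‖z‖²·weight·e^{a₅|Z|} on `D k′`; node N18 below `k` at the same reading;
the letter signs with `li.s = ½`, `li.μ = 1`, `0 < li.r ≤ min(cA, 1)` ⟹ `N22At (u3OfRecord₁₂ θ (Dr.u3Objects θ.γ) k)` for `Dr := ReadingData.ofRecordAdm F M N (runTowers fun k₁ ↦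
toClusterTower (Gn k₁)) sp gauge hg T₀ hT₀ li`.  Proof: R1a §2 + R1b §2 at `Kr := k` for `TFc` (numerals at `a₅′`), the canonical section `z ↦ recTerm (GenTower.ofTerms L TFc) (↑g|i:=z) j X
(ιU,0)` IS the reading's complexified section (`functionalC_truncRun_of_le`, `functionalC_toClusterTower`, `Gn_eq`, R1b `recTerm_ofTerms_congr_couplings`), §1's reflection, the levels
beyond the run length are termless (`termlessBeyond_runTowers`), then R0 §3. [cite: Balaban1988RG2Cluster, (1.41) p.11, (2.9)-(2.15) pp.14-16, (2.26) p.17, Lemma 3 p.20 and (2.39)-(2.41) p.21; Balaban1987RG1, §1 p.263, (2.9)-(2.10) pp.266-267 and (2.13) p.268] -/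
theorem n22At_u3OfRecord₁₂_ofRecordAdm_runTowers_toClusterTower_of_n18Below_relCentredTermDatumAdm {cs : SFConsts} (hGn : Gn k = 𝔇.Gn)
    (hspk : ∀ (j : ℕ) (Y : (domSys (F.P k) M j).Dom), sp k j Y ⊆ spaceI Sg Rz M j (domSites (F.P k) M j Y) cs.α₀ cs.α₁)
    (hrestr : ∀ j : ℕ, SpRestr (M := M) (fun Y : (domSys (F.P k) M (j + 1)).Dom => spaceI Sg Rz M (j + 1) (domSites (F.P k) M (j + 1) Y) cs.α₀ cs.α₁))
    (hL : 8 ≤ c.L) (hLc : c.L = L) {a a₂ a₂' a₅ a₅' Aabs : ℝ} (hN : Lemma3Numerics c M ((c.L : ℝ) / 2) a a₂ a₂' a₅' Aabs)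
    {E₀ r₁ Mv cA : ℝ} (hA0 : 0 ≤ c.C3act * c.ε₁) (hr₁ : 0 ≤ r₁) (hκ : li.κ ≤ r₁)
    (hrate : r₁ + 2 * (64 * Real.log 162) + 2 ≤ (1 - 8 * c.δ) * ((c.L : ℝ) / 2) * c.κ)
    (hsmall : c.C3act * c.ε₁ * Real.exp (5 * r₁ + 1) * K₀ 64 8 * 9 * 64 < 1)
    (hrenew : Real.exp 1 * 9 * 64 * K₀ 64 8 ^ 2 * (c.C3act * c.ε₁) ≤ E₀)
    (h2w : ∀ (k' : ℕ) (Z : (domSys (F.P k) M (k' + 1)).Dom), 2 * Real.exp (a₅ * ((Z.1).card : ℝ)) ≤ Real.exp (a₅' * ((Z.1).card : ℝ)))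
    (hDo : ∀ i, IsOpen (D i)) (hDw : ∀ (i : ℕ), ∀ t ∈ Ioc (0 : ℝ) θ.γ, ((t : ℝ) : ℂ) ∈ D i)
    (hDd : ∀ (i : ℕ), ∀ t ∈ Ioc (0 : ℝ) θ.γ, closedBall (t : ℂ) (cA * t) ⊆ D i) (hc0 : 0 < cA) (hc1 : cA < 1)
    (hMv : 0 < Mv) (hMvγ : Mv * ((1 + cA) * θ.γ) ^ 2 ≤ 1 / 2) (hAM : 2 * Mv * E₀ * (1 + cA) ^ 2 ≤ li.A)
    (hagree : ∀ (k' : ℕ) (Z : (domSys (F.P k) M (k' + 1)).Dom) (t : TermLabel (F.P k) M k' L) (s : ℝ), s ∈ Ioc (0 : ℝ) θ.γ →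
      ∀ (old : OlderTerms (F.P k) (MatA N) M k') (φ : CPair (F.P k) (MatA N)), TFc k' Z t (s : ℂ) old φ = (𝔇 k').TF Z t (s : ℂ) old φ)
    (hTanD : ∀ k' : ℕ, k' < k → ∀ u ∈ D k', ∀ old : OlderTerms (F.P k) (MatA N) M k',
      (∀ (j : Fin (k' + 1)) (Y : (domSys (F.P k) M j).Dom), ∀ ψ ∈ spaceI Sg Rz M j (domSites (F.P k) M j Y) cs.α₀ cs.α₁,
          ‖old j Y ψ‖ ≤ E₀ * Real.exp (-(r₁ * (domSys (F.P k) M j).dj Y))) →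
      (∀ (j : Fin (k' + 1)) (Y : (domSys (F.P k) M j).Dom), AnalyticOnNhd ℂ (old j Y) (spaceI Sg Rz M j (domSites (F.P k) M j Y) cs.α₀ cs.α₁)) →
      ∀ (Z : (domSys (F.P k) M (k' + 1)).Dom), ∀ τ ∈ terms L M Z,
        AnalyticOnNhd ℂ (fun φ => TFc k' Z τ u old φ) (spaceI Sg Rz M (k' + 1) (domSites (F.P k) M (k' + 1) Z) cs.α₀ cs.α₁))
    (hVanD : ∀ k' : ℕ, k' < k → ∀ old : OlderTerms (F.P k) (MatA N) M k',
      (∀ (j : Fin (k' + 1)) (Y : (domSys (F.P k) M j).Dom), ∀ ψ ∈ spaceI Sg Rz M j (domSites (F.P k) M j Y) cs.α₀ cs.α₁,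
          ‖old j Y ψ‖ ≤ E₀ * Real.exp (-(r₁ * (domSys (F.P k) M j).dj Y))) →
      (∀ (j : Fin (k' + 1)) (Y : (domSys (F.P k) M j).Dom), AnalyticOnNhd ℂ (old j Y) (spaceI Sg Rz M j (domSites (F.P k) M j Y) cs.α₀ cs.α₁)) →
      ∀ (Z : (domSys (F.P k) M (k' + 1)).Dom), ∀ τ ∈ terms L M Z,
        AnalyticOnNhd ℂ (fun φ => V k' Z τ old φ) (spaceI Sg Rz M (k' + 1) (domSites (F.P k) M (k' + 1) Z) cs.α₀ cs.α₁))
    (hlast : ∀ k' : ℕ, k' < k → ∀ old : OlderTerms (F.P k) (MatA N) M k',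
      (∀ (j : Fin (k' + 1)) (Y : (domSys (F.P k) M j).Dom) (ψ : CPair (F.P k) (MatA N)), ψ ∈ spaceI Sg Rz M j (domSites (F.P k) M j Y) cs.α₀ cs.α₁ →
        ‖old j Y ψ‖ ≤ E₀ * Real.exp (-(li.κ * torusTreeLen Y.1))) →
      (∀ (j : Fin (k' + 1)) (Y : (domSys (F.P k) M j).Dom), AnalyticOnNhd ℂ (old j Y) (spaceI Sg Rz M j (domSites (F.P k) M j Y) cs.α₀ cs.α₁)) →
      ∀ (X : (domSys (F.P k) M (k' + 1)).Dom) (φ : CPair (F.P k) (MatA N)), φ ∈ spaceI Sg Rz M (k' + 1) (domSites (F.P k) M (k' + 1) X) cs.α₀ cs.α₁ →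
        ∀ (Z : (domSys (F.P k) M (k' + 1)).Dom), Z.1 ⊆ X.1 → ∀ t ∈ terms L M Z,
          DifferentiableOn ℂ (fun z => TFc k' Z t z old φ) (D k') ∧ ∀ z ∈ D k', ‖TFc k' Z t z old φ‖ ≤ weight L M c Z a t * Real.exp (a₅ * ((Z.1).card : ℝ)))
    (hprop : ∀ k' : ℕ, k' < k → ∀ i : ℕ, i < k' → ∀ (O : Set ℂ), IsOpen O → ∀ u ∈ D k', ∀ cv : ℂ → OlderTerms (F.P k) (MatA N) M k',
      (∀ (j : Fin (k' + 1)) (Y : (domSys (F.P k) M j).Dom) (ψ : CPair (F.P k) (MatA N)), ψ ∈ spaceI Sg Rz M j (domSites (F.P k) M j Y) cs.α₀ cs.α₁ →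
        DifferentiableOn ℂ (fun z => cv z j Y ψ) O ∧ ∀ z ∈ O, ‖cv z j Y ψ‖ ≤ E₀ * Real.exp (-(li.κ * torusTreeLen Y.1))) →
      (∀ z ∈ O, ∀ (j : Fin (k' + 1)) (Y : (domSys (F.P k) M j).Dom), AnalyticOnNhd ℂ (cv z j Y) (spaceI Sg Rz M j (domSites (F.P k) M j Y) cs.α₀ cs.α₁)) →
      ∀ (X : (domSys (F.P k) M (k' + 1)).Dom) (φ : CPair (F.P k) (MatA N)), φ ∈ spaceI Sg Rz M (k' + 1) (domSites (F.P k) M (k' + 1) X) cs.α₀ cs.α₁ →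
        ∀ (Z : (domSys (F.P k) M (k' + 1)).Dom), Z.1 ⊆ X.1 → ∀ t ∈ terms L M Z,
          DifferentiableOn ℂ (fun z => TFc k' Z t u (cv z) φ) O ∧ ∀ z ∈ O, ‖TFc k' Z t u (cv z) φ‖ ≤ weight L M c Z a t * Real.exp (a₅ * ((Z.1).card : ℝ)))
    (hpropV : ∀ k' : ℕ, k' < k → ∀ (O : Set ℂ), IsOpen O → ∀ cv : ℂ → OlderTerms (F.P k) (MatA N) M k',
      (∀ (j : Fin (k' + 1)) (Y : (domSys (F.P k) M j).Dom) (ψ : CPair (F.P k) (MatA N)), ψ ∈ spaceI Sg Rz M j (domSites (F.P k) M j Y) cs.α₀ cs.α₁ →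
        DifferentiableOn ℂ (fun z => cv z j Y ψ) O ∧ ∀ z ∈ O, ‖cv z j Y ψ‖ ≤ E₀ * Real.exp (-(li.κ * torusTreeLen Y.1))) →
      (∀ z ∈ O, ∀ (j : Fin (k' + 1)) (Y : (domSys (F.P k) M j).Dom), AnalyticOnNhd ℂ (cv z j Y) (spaceI Sg Rz M j (domSites (F.P k) M j Y) cs.α₀ cs.α₁)) →
      ∀ (X : (domSys (F.P k) M (k' + 1)).Dom) (φ : CPair (F.P k) (MatA N)), φ ∈ spaceI Sg Rz M (k' + 1) (domSites (F.P k) M (k' + 1) X) cs.α₀ cs.α₁ →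
        ∀ (Z : (domSys (F.P k) M (k' + 1)).Dom), Z.1 ⊆ X.1 → ∀ t ∈ terms L M Z,
          DifferentiableOn ℂ (fun z => V k' Z t (cv z) φ) O ∧ ∀ z ∈ O, ‖V k' Z t (cv z) φ‖ ≤ weight L M c Z a t * Real.exp (a₅ * ((Z.1).card : ℝ)))
    (hcen : ∀ k' : ℕ, k' < k → ∀ old : OlderTerms (F.P k) (MatA N) M k',
      (∀ (j : Fin (k' + 1)) (Y : (domSys (F.P k) M j).Dom) (ψ : CPair (F.P k) (MatA N)), ψ ∈ spaceI Sg Rz M j (domSites (F.P k) M j Y) cs.α₀ cs.α₁ →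
        ‖old j Y ψ‖ ≤ E₀ * Real.exp (-(li.κ * torusTreeLen Y.1))) →
      (∀ (j : Fin (k' + 1)) (Y : (domSys (F.P k) M j).Dom), AnalyticOnNhd ℂ (old j Y) (spaceI Sg Rz M j (domSites (F.P k) M j Y) cs.α₀ cs.α₁)) →
      ∀ (X : (domSys (F.P k) M (k' + 1)).Dom) (φ : CPair (F.P k) (MatA N)), φ ∈ spaceI Sg Rz M (k' + 1) (domSites (F.P k) M (k' + 1) X) cs.α₀ cs.α₁ →
        ∀ (Z : (domSys (F.P k) M (k' + 1)).Dom), Z.1 ⊆ X.1 → ∀ t ∈ terms L M Z,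
          ∀ z ∈ D k', ‖TFc k' Z t z old φ - V k' Z t old φ‖ ≤ Mv * ‖z‖ ^ 2 * (weight L M c Z a t * Real.exp (a₅ * ((Z.1).card : ℝ))))
    (h18 : ∀ k' : ℕ, k' < k →
      N18At (u3OfRecord₁₂ θ ((ReadingData.ofRecordAdm F M N (runTowers fun k₁ => toClusterTower (Gn k₁)) sp gauge hg T₀ hT₀ li).u3Objects θ.γ) k'))
    (hC5 : 0 ≤ li.C₅) (hθ1 : li.θ₅ < 1) (hC₀' : 2 * li.C₅ / (1 - li.θ₅) ≤ li.C₀)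
    (hC₀ : 0 < li.C₀) (hθ5 : 0 < li.θ₅) (hA : 0 < li.A) (hμ : li.μ = 1) (hr : 0 < li.r) (hrc : li.r ≤ min cA 1) (hγ : 0 < θ.γ) (hs : li.s = (2 : ℝ)⁻¹) :
    N22At (u3OfRecord₁₂ θ ((ReadingData.ofRecordAdm F M N (runTowers fun k₁ => toClusterTower (Gn k₁)) sp gauge hg T₀ hT₀ li).u3Objects θ.γ) k) := by
  have hA6 : 0 ≤ c.α₆ * c.eps2 := mul_nonneg hN.hα₆.le hN.hε₀
  have hE₀ : 0 ≤ E₀ := le_trans (by positivity) hrenew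
  -- the space tables of record as the heredity's tables
  set tab : (j : ℕ) → (domSys (F.P k) M j).Dom → Set (CPair (F.P k) (MatA N)) := fun j Y => spaceI Sg Rz M j (domSites (F.P k) M j Y) cs.α₀ cs.α₁ with htab
  -- the weight upgrade from `a₅` to `a₅′`
  have hexp : ∀ (k' : ℕ) (Z : (domSys (F.P k) M (k' + 1)).Dom), Real.exp (a₅ * ((Z.1).card : ℝ)) ≤ Real.exp (a₅' * ((Z.1).card : ℝ)) := fun k' Z =>
    le_trans (by linarith [Real.exp_pos (a₅ * ((Z.1).card : ℝ))]) (h2w k' Z)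
  have hw_up : ∀ (k' : ℕ) (Z : (domSys (F.P k) M (k' + 1)).Dom) (t : TermLabel (F.P k) M k' L) (x : ℝ),
      x ≤ weight L M c Z a t * Real.exp (a₅ * ((Z.1).card : ℝ)) → x ≤ weight L M c Z a t * Real.exp (a₅' * ((Z.1).card : ℝ)) := fun k' Z t x hx =>
    hx.trans (mul_le_mul_of_nonneg_left (hexp k' Z) (weight_nonneg c Z a hA6 t))
  -- R1a §2 for the continued family at the letter `a₅′`, tables of record, run length `k`
  have H1 := holoBound_recTerm_ofTerms_adm F k L TFc tab hrestr c hL hLc hN hA0 hr₁ hκ hrate hsmall hrenew D hDo hDw k hTanD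
    (fun k' hk old hold han X φ hφ Z hZ t ht => by
      obtain ⟨hd, hb⟩ := hlast k' hk old hold han X φ hφ Z hZ t ht
      exact ⟨hd, fun z hz => hw_up k' Z t _ (hb z hz)⟩)
    (fun k' hk i hi u hu cv hcv hcvA X φ hφ Z hZ t ht => by
      obtain ⟨hd, hb⟩ := hprop k' hk i hi (D i) (hDo i) u hu cv hcv hcvA X φ hφ Z hZ t ht
      exact ⟨hd, fun z hz => hw_up k' Z t _ (hb z hz)⟩)
  -- R1bᴬ §3 for the continued family
  have H2 := centred_recTerm_ofTerms_adm F k L TFc V tab hrestr c hL hLc hN hA0 hr₁ hκ hrate hsmall hrenew h2w D hDo hDw k hTanD hVanD hlast hprop hpropV hcen hMv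
  refine n22At_u3OfRecord₁₂_ofRecordAdm_runTowers_of_n18Below_relCentred (fun k₁ => toClusterTower (Gn k₁)) sp gauge hg T₀ hT₀ li θ k (c := cA) ?_ h18 hC5 hθ1 hC₀'
    hC₀ hθ5 hA (by rw [hμ]; exact hθ1.le) hc0 hr hrc hγ hs
  -- THE SLOT (A₂ᶜ) for the sections of the run tower of the run length `k`
  intro g hg' U X i hi
  set φ : CPair (F.P k) (MatA N) := ofBackgroundC (ιSU N) U.1 with hφdef
  have hφ : ∀ (j : ℕ) (Y : (domSys (F.P k) M j).Dom), φ ∈ tab j Y := fun j Y => hspk j Y (U.2 j Y)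
  by_cases hXk : X.1 ≤ k
  · -- a level of the run: the canonical complexified section of the continued family
    set gc : ℕ → ℂ := fun n => ((g n : ℝ) : ℂ) with hgc
    set Fc : ℂ → ℂ := fun z => recTerm (GenTower.ofTerms L TFc) (Function.update gc i z) X.1 X.2 φ with hFc
    -- the reading's real functional at the updated history IS the section at the real point
    have hid : ∀ t ∈ Ioc (0 : ℝ) θ.γ, functionalC (runTowers (fun k₁ => toClusterTower (Gn k₁)) k) (Function.update g i t) φ X = Fc t := by
      intro t ht
      have hwin : ∀ n, Function.update g i t n ∈ Ioc (0 : ℝ) θ.γ := fun n => by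
        rcases eq_or_ne n i with rfl | hne
        · rw [Function.update_self]; exact ht
        · rw [Function.update_of_ne hne]; exact hg' n
      have hup : (fun n => ((Function.update g i t n : ℝ) : ℂ)) = Function.update gc i (t : ℂ) := by
        funext n
        rcases eq_or_ne n i with rfl | hne
        · rw [Function.update_self, Function.update_self]
        · rw [Function.update_of_ne hne, Function.update_of_ne hne]
      rw [runTowers_apply, functionalC_truncRun_of_le _ _ _ _ hXk, hGn, functionalC_toClusterTower, TermData214.Gn_eq, hFc]
      show recTerm (GenTower.ofTerms L 𝔇.TF) (fun n => ((Function.update g i t n : ℝ) : ℂ)) X.1 X.2 φ = _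
      rw [hup]
      refine (recTerm_ofTerms_congr_couplings F k L (TF₁ := TFc) (TF₂ := 𝔇.TF) (h := Function.update gc i (t : ℂ)) (fun k' Z tl old ψ => ?_) X.1 X.2 φ).symm
      have hk'v : Function.update gc i (t : ℂ) k' = ((Function.update g i t k' : ℝ) : ℂ) := by rw [← hup]
      rw [hk'v, TermData214.TF_apply]
      exact hagree k' Z tl _ (hwin k') old ψ
    -- holomorphy of the section on `D i` (R1a) and the centred letter w.r.t. the vertex tower (R1b)
    obtain ⟨-, hsec⟩ := H1 X.1 hXk g hg' X.2 φ (hφ X.1 X.2)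
    obtain ⟨hhol, hbd⟩ := hsec i hi
    set e₀c : ℂ := recTerm (GenTower.ofTerms L (Function.update TFc i fun Z t _ old φ => V i Z t old φ)) gc X.1 X.2 φ with he₀c
    have hcen' : ∀ t ∈ Ioc (0 : ℝ) θ.γ, ∀ z ∈ closedBall (t : ℂ) (cA * t),
        ‖Fc z - e₀c‖ ≤ 2 * Mv * E₀ * (1 + cA) ^ 2 * Real.exp (-(li.κ * torusTreeLen (Subtype.val X.2))) * t ^ 2 := by
      intro t ht z hz
      rw [mem_closedBall, dist_eq_norm] at hz
      have ht0 : 0 < t := ht.1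
      have hzn : ‖z‖ ≤ (1 + cA) * t := by
        calc ‖z‖ = ‖(z - (t : ℂ)) + (t : ℂ)‖ := by rw [sub_add_cancel]
          _ ≤ ‖z - (t : ℂ)‖ + ‖(t : ℂ)‖ := norm_add_le _ _
          _ ≤ cA * t + t := by rw [Complex.norm_real, Real.norm_eq_abs, abs_of_pos ht0]; exact add_le_add hz le_rfl
          _ = (1 + cA) * t := by ring
      have hzl : (1 - cA) * t ≤ ‖z‖ := by
        have h1 : ‖(t : ℂ)‖ ≤ ‖(t : ℂ) - z‖ + ‖z‖ := by
          calc ‖(t : ℂ)‖ = ‖((t : ℂ) - z) + z‖ := by rw [sub_add_cancel]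
            _ ≤ ‖(t : ℂ) - z‖ + ‖z‖ := norm_add_le _ _
        rw [Complex.norm_real, Real.norm_eq_abs, abs_of_pos ht0, norm_sub_rev] at h1
        nlinarith
      have hzne : z ≠ 0 := by
        intro h0
        rw [h0, norm_zero] at hzl
        nlinarith
      have hq : Mv * ‖z‖ ^ 2 ≤ 1 / 2 := by
        calc Mv * ‖z‖ ^ 2 ≤ Mv * ((1 + cA) * θ.γ) ^ 2 := by
              refine mul_le_mul_of_nonneg_left ?_ hMv.le
              exact pow_le_pow_left₀ (norm_nonneg _) (hzn.trans (mul_le_mul_of_nonneg_left ht.2 (by linarith))) 2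
          _ ≤ 1 / 2 := hMvγ
      have hzD : z ∈ D i := hDd i t ht (by rw [mem_closedBall, dist_eq_norm]; exact hz)
      have key := H2 X.1 hXk g hg' i hi X.2 φ (hφ X.1 X.2) z hzD hzne hq
      calc ‖Fc z - e₀c‖ ≤ 2 * (Mv * ‖z‖ ^ 2) * (E₀ * Real.exp (-(li.κ * torusTreeLen (Subtype.val X.2)))) := key
        _ ≤ 2 * (Mv * ((1 + cA) * t) ^ 2) * (E₀ * Real.exp (-(li.κ * torusTreeLen (Subtype.val X.2)))) := by
            gcongr
        _ = 2 * Mv * E₀ * (1 + cA) ^ 2 * Real.exp (-(li.κ * torusTreeLen (Subtype.val X.2))) * t ^ 2 := by ring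
    -- Schwarz reflection: the real trace
    obtain ⟨Fz, Dset, e₁, hFz, hdiscs, hB, htr⟩ := relCentred_re_section (f := fun t => (functionalC (runTowers (fun k₁ => toClusterTower (Gn k₁)) k)
      (Function.update g i t) φ X).re) (hDo i) hhol (hDd i) hcen' (fun t ht => by rw [hid t ht])
    refine ⟨Fz, Dset, e₁, hFz, hdiscs, fun t ht z hz => ?_, fun t ht => htr t ht⟩
    show ‖Fz z - e₁‖ ≤ li.A * li.μ ^ (X.1 - 1 - i) * t ^ 2 * Real.exp (-(li.κ * torusTreeLen (Subtype.val X.2)))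
    refine (hB t ht z hz).trans ?_
    rw [hμ, one_pow, mul_one]
    have hpos : 0 ≤ Real.exp (-(li.κ * torusTreeLen (Subtype.val X.2))) * t ^ 2 := by positivity
    calc 2 * Mv * E₀ * (1 + cA) ^ 2 * Real.exp (-(li.κ * torusTreeLen (Subtype.val X.2))) * t ^ 2
        = (2 * Mv * E₀ * (1 + cA) ^ 2) * (Real.exp (-(li.κ * torusTreeLen (Subtype.val X.2))) * t ^ 2) := by ring
      _ ≤ li.A * (Real.exp (-(li.κ * torusTreeLen (Subtype.val X.2))) * t ^ 2) := mul_le_mul_of_nonneg_right hAM hpos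
      _ = li.A * t ^ 2 * Real.exp (-(li.κ * torusTreeLen (Subtype.val X.2))) := by ring
  · -- beyond the run length: no term
    have hXk' : k < X.1 := Nat.lt_of_not_le hXk
    refine ⟨fun _ => 0, univ, 0, differentiableOn_const 0, fun _ _ => subset_univ _, fun t ht z _ => ?_, fun t ht => ?_⟩
    · rw [sub_zero, norm_zero, hμ, one_pow, mul_one]
      positivity
    · simp only [(termlessBeyond_runTowers (fun k₁ => toClusterTower (Gn k₁)) k).functionalC_eq_zero _ _ X hXk', Complex.zero_re,
        Complex.ofReal_zero]

end Engine

end YMDAG.N22.W1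

end
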